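import Summits.ResolutionOfSingularities.ResolutionOfSingularities.Theorems.EquisingularLiftEquisingularLiftBlowupModelFour
import Literature.AlgebraicGeometry.Resolution.LipmanTermination
import Literature.AlgebraicGeometry.Resolution.SurfaceResolutionReduction
import Literature.AlgebraicGeometry.Resolution.ProjectiveBirationalBlowupProofs
import Literature.AlgebraicGeometry.Resolution.AlterationsNormalizationReduction
import Literature.AlgebraicGeometry.Resolution.AlterationsBlowupDivisorProofs
import Literature.AlgebraicGeometry.Resolution.RegularCentreBlowupSeqExtension
import HarnessLib

/-!
# Crux `EquisingularLift` (stmt-ResolutionOfSingularities-15660), line `Sketch` (skeleton v10c `f3e6993bf39ec5c9`):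
# the `n = 3` leaf from LIPMAN'S THEOREM (Liu 2002 Thm. 8.3.44) via Liu 2002 Thm. 8.1.24 — a second, CJS-free source

[OURS · leafhand-res-equisingularlift-1 g1, 2026-08-31] AI-produced, weaker than expert review; NOT a statement of any
manuscript; nothing here proves resolution of singularities in positive characteristic.

The `n = 3` leaf `stub_blowupModel_three` of the line (every integral closed `H ⊆ ℙ³_k`, `k = k̄` of characteristic `p`,
with locally principal ideal has a non-zero ideal sheaf ALL of whose blow-ups are regular) is in the tree conditionally on
Cossart–Jannsen–Saito (`stub_blowupModel_three_of_CJS`; reduced to CJS Thm. 6.28 by `…CJS2020SequenceOfSigmaMax`, p798090).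
This file gives it an INDEPENDENT source, the textbook theorem on surfaces:

* `Lipman1978SequenceFinite` (NAMED FACT of the tree, `LipmanTermination.lean`; Liu 2002 Thm. 8.3.44 = Lipman 1978, restricted
  to integral normal surfaces of finite type over a field: some iterate `X_n` of "blow up the reduced singular locus, then
  normalize" is regular).

Route (all tools PROVED in the tree): for an integral projective surface `H ⊆ ℙⁿ_k`, its normalization `H^ν` is an integral
normal PROJECTIVE surface (`isProjectiveOver_normalization`, finiteness of normalization — E. Noether — discharged); every
Lipman step `X_{i+1} → X_i` (blow-up of the singular locus, then normalization) is projective (`IsBlowup.isProjectiveOver`,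
`isProjectiveOver_normalization`) and birational, so the regular iterate `X_n` is an integral projective `k`-scheme with a
birational `k`-morphism `X_n → H`; by **Liu 2002 Thm. 8.1.24** (DISCHARGED in the tree, `Liu2002Thm8124Projective_holds`:
a birational morphism of integral projective `k`-schemes is a blow-up along a non-zero ideal sheaf) `X_n → H` is the
blow-up of some `𝔞 ≠ ⊥`, and every blow-up of `𝔞` is isomorphic to the regular `X_n` (`IsBlowup.unique`).

* `normalSurface_isProjectiveOver_step` / `normalSurface_iterate_isProjectiveOver_isBirational` — projectivity and
  birationality along Lipman's sequence (3.11);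
* `blowupModel_of_lipman1978SequenceFinite` — regular blow-up models of integral projective surfaces over any field, modulo
  the fact;
* `stub_blowupModel_three_of_lipman1978SequenceFinite` — the registered `stub_blowupModel_three` signature verbatim after the
  one fact binder.

Honest label: CONDITIONAL on one unproved published theorem (Lipman 1978 / Liu 8.3.44); no stub is closed by this file.

References: [Liu2002, Thm. 8.3.44 (p. 362), Thm. 8.1.24]; [Lipman1978, Theorem p. 151]; [Hartshorne1977, II.7.17].
-/

set_option linter.dupNamespace false -- mandated namespace `Summit.<Summit>.<Problem>` of this single-conjunct summit

noncomputable section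

open CategoryTheory CategoryTheory.Limits AlgebraicGeometry TopologicalSpace
open Literature.AlgebraicGeometry.Resolution Literature.AlgebraicGeometry.Motives

universe u

namespace Summit.ResolutionOfSingularities.ResolutionOfSingularities.Cruxes.EquisingularLift.StrataSplit

/-! ## Lipman's sequence (3.11) stays projective and birational -/

/-- **One Lipman step of a projective normal surface is projective over `k`**: the blow-up of the singular locus is
projective over `k` (`IsBlowup.isProjectiveOver`) and so is its normalization (`isProjectiveOver_normalization`, finiteness
of normalization). [cite: Liu2002, §8.3.4 (3.11) p. 362] -/
theorem normalSurface_isProjectiveOver_step {k : Type u} [Field k] (S : NormalSurface k)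
    (h : IsProjectiveOver (Over.mk S.hom)) : IsProjectiveOver (Over.mk S.step.hom) := by
  have h1 : IsProjectiveOver (Over.mk (singBlowup.π S.X S.hom ≫ S.hom)) :=
    IsBlowup.isProjectiveOver S.hom h (blowup.isBlowup _)
  have h2 := isProjectiveOver_normalization (X := singBlowup S.X S.hom) (singBlowup.π S.X S.hom ≫ S.hom) h1
  have e : S.step.hom = normalizationι (singBlowup S.X S.hom) ≫ singBlowup.π S.X S.hom ≫ S.hom := by
    rw [NormalSurface.step_hom, NormalSurface.stepπ, lipmanStep.π]
    exact Category.assoc _ _ _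
  rw [e]
  exact h2

/-- **The `n`-th iterate of Lipman's sequence of a projective normal surface is projective over `k` and maps birationally
onto it, compatibly with the structure morphisms.** [cite: Liu2002, §8.3.4 (3.11) p. 362] -/
theorem normalSurface_iterate_isProjectiveOver_isBirational {k : Type u} [Field k] :
    ∀ (n : ℕ) (S : NormalSurface k), IsProjectiveOver (Over.mk S.hom) →
      IsProjectiveOver (Over.mk (NormalSurface.step^[n] S).hom) ∧
        ∃ π : (NormalSurface.step^[n] S).X ⟶ S.X, IsBirational π ∧ π ≫ S.hom = (NormalSurface.step^[n] S).hom
  | 0, S, h => ⟨h, 𝟙 _, isBirational_id _, Category.id_comp _⟩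
  | n + 1, S, h => by
    obtain ⟨hp, π, hπ, hcomp⟩ :=
      normalSurface_iterate_isProjectiveOver_isBirational n S.step (normalSurface_isProjectiveOver_step S h)
    refine ⟨hp, π ≫ S.stepπ, hπ.comp S.isBirational_stepπ, ?_⟩
    rw [Category.assoc, ← NormalSurface.step_hom]
    exact hcomp

/-! ## Regular blow-up models of projective surfaces from Lipman's theorem -/

/-- **Every integral projective surface over a field has a non-zero ideal sheaf all of whose blow-ups are regular,
modulo Lipman's theorem** (`Lipman1978SequenceFinite`, Liu 2002 Thm. 8.3.44 for integral normal surfaces over fields):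
normalize (`H^ν` is an integral normal projective surface), run Lipman's sequence to a regular `X_m` (projective over `k`,
birational over `H`), and apply Liu 2002 Thm. 8.1.24 (`Liu2002Thm8124Projective_holds`, DISCHARGED): the birational
`k`-morphism `X_m → H` of integral projective `k`-schemes is a blow-up along some `𝔞 ≠ ⊥`; blow-ups of `𝔞` are unique up to
isomorphism. [cite: Liu2002, Thm. 8.3.44, Thm. 8.1.24] [cite: Lipman1978, Theorem p. 151] -/
theorem blowupModel_of_lipman1978SequenceFinite (hL : Lipman1978SequenceFinite.{u}) {k : Type u} [Field k] {n : ℕ}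
    {H : Scheme.{u}} [IsIntegral H] (ι : H ⟶ (projectiveSpace n k).left) [IsClosedImmersion ι]
    (hdim : topologicalKrullDim H = 2) :
    ∃ 𝔞 : H.IdealSheafData, 𝔞 ≠ ⊥ ∧
      ∀ (Z : Scheme.{u}) (π : Z ⟶ H), IsBlowup π 𝔞 → Scheme.IsRegular Z := by
  haveI : IsProper (projectiveSpace n k).hom := isProper_projectiveSpace n k
  let f : H ⟶ Spec (.of k) := ι ≫ (projectiveSpace n k).hom
  have hHproj : IsProjectiveOver (Over.mk f) := ⟨n, Over.homMk ι rfl, ‹IsClosedImmersion ι›⟩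
  -- the normalization `H^ν`, an integral normal projective surface
  haveI : IsFinite (normalizationι H) := isFinite_normalizationι H NoetherFiniteIntegralClosure_holds f
  let S : NormalSurface k :=
    { X := normalization H
      hom := normalizationι H ≫ f
      isSeparated := inferInstance
      locallyOfFiniteType := inferInstance
      quasiCompact := inferInstance
      isIntegral := inferInstance
      normal := isIntegrallyClosed_stalk_normalization H
      dim_eq := by rw [topologicalKrullDim_normalization H f, hdim] }
  have hSproj : IsProjectiveOver (Over.mk S.hom) := isProjectiveOver_normalization (X := H) f hHproj
  -- Lipman: some iterate is regular; it is projective over `k` and birational over `H^ν`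
  obtain ⟨m, hreg⟩ := hL k S
  obtain ⟨hproj, π, hπ, hcomp⟩ := normalSurface_iterate_isProjectiveOver_isBirational m S hSproj
  have hbir : IsBirational (π ≫ normalizationι H) := hπ.comp (isBirational_normalizationι H f)
  have hcomm : (π ≫ normalizationι H) ≫ f = (NormalSurface.step^[m] S).hom := by
    rw [Category.assoc]; exact hcomp
  -- Liu 8.1.24: a birational morphism of integral projective `k`-schemes is a blow-up of a non-zero ideal
  obtain ⟨I, hI0, hI⟩ := Liu2002Thm8124Projective_holds k (NormalSurface.step^[m] S).X H (π ≫ normalizationι H)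
    (NormalSurface.step^[m] S).hom f inferInstance inferInstance hproj hHproj hcomm hbir
  refine ⟨I, hI0, fun Z π' hπ' => ?_⟩
  obtain ⟨e, -, -⟩ := hI.unique hπ'
  exact hreg.of_iso e.hom

/-! ## The `n = 3` leaf of the line, conditional on Lipman's theorem alone -/

/-- **The `n = 3` leaf `stub_blowupModel_three` CONDITIONAL on `Lipman1978SequenceFinite.{0}` alone** (Liu 2002 Thm. 8.3.44;
after the fact binder the type is the registered signature verbatim): if `ι` is an isomorphism, `H ≅ ℙ³_k` is regular and
`𝔞 = ⊤` (`exists_blowupModel_of_isRegular`); otherwise `H` is an integral surface (`topologicalKrullDim_of_hypersurface`) and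
`blowupModel_of_lipman1978SequenceFinite` applies. A CJS-free alternative to `stub_blowupModel_three_of_CJS` /
`stub_blowupModel_three_of_sigmaMaxElimination`. [cite: Liu2002, Thm. 8.3.44, Thm. 8.1.24] [cite: Lipman1978, Theorem p. 151] -/
theorem stub_blowupModel_three_of_lipman1978SequenceFinite (hL : Lipman1978SequenceFinite.{0}) : ∀ p : ℕ, p.Prime → ∀ (k : Type) [Field k] [CharP k p] [IsAlgClosed k] (n : ℕ) (H : AlgebraicGeometry.Scheme.{0}) (ι : H ⟶ (Literature.AlgebraicGeometry.Motives.projectiveSpace n k).left), AlgebraicGeometry.IsClosedImmersion ι → AlgebraicGeometry.IsIntegral H → (∀ y : (Literature.AlgebraicGeometry.Motives.projectiveSpace n k).left, ∃ U : (Literature.AlgebraicGeometry.Motives.projectiveSpace n k).left.affineOpens, y ∈ (U : (Literature.AlgebraicGeometry.Motives.projectiveSpace n k).left.Opens) ∧ (ι.ker.ideal U).IsPrincipal) → n = 3 → ∃ 𝔞 : H.IdealSheafData, 𝔞 ≠ ⊥ ∧ ∀ (Z : AlgebraicGeometry.Scheme.{0}) (π : Z ⟶ H), Literature.AlgebraicGeometry.Resolution.IsBlowup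 π 𝔞 → Literature.AlgebraicGeometry.Resolution.Scheme.IsRegular Z := by
  intro p hp k _ _ _ n H ι hι hH hloc hn
  subst hn
  by_cases hiso : IsIso ι
  · -- `H = ℙ³_k` is regular
    exact exists_blowupModel_of_isRegular
      (Scheme.IsRegular.of_iso (inv ι) (isRegular_projectiveSpace 3 k))
  · -- `H` is an integral surface
    have hdim : topologicalKrullDim H = 2 := by
      rw [topologicalKrullDim_of_hypersurface (n := 2) ι hloc hiso]; rfl
    exact blowupModel_of_lipman1978SequenceFinite hL ι hdim

end Summit.ResolutionOfSingularities.ResolutionOfSingularities.Cruxes.EquisingularLift.StrataSplit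

end
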